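/-
Copyright: public-domain mathematics; typed transcription for the H21 Literature library (cell pub-balaban, PAPER SUB-CELL B05 gen 6).

# Bałaban, *Propagators and renormalization transformations for lattice gauge theories. I*,
# Commun. Math. Phys. **95** (1984) 17–40 — the field `h128` of the contract `B5Local114.Realisation`
# as a stand-alone predicate, SUPPLIED by the torus model of `B5AveragingTorus`

[cite: Balaban1984PropagatorsI]  T. Bałaban, Commun. Math. Phys. 95 (1984) 17–40 (= B5 of the series).  NO new
printed locus is read or quoted by this module; the two quotations below are RE-USED VERBATIM from render-certified
headers in the tree (p. 38 (1.128): header of `B5Local114` (cell GAPS C-B5-27/28) and field docstring of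
`B5Local114.Realisation.h128`; p. 36: header of `B5Local114.Realisation`), journal page = PDF page + 16:

p. 38 [PDF 22], (1.128): "Defining `2δ₀ = min{⅓δ′₀, M₀⁻¹}`, we obtain
`|h_{z₁}K(h_{z₂})A| ≤ O(M₀⁻¹) e^{−2δ₀|z₁−z₂|} (|∇A| + |A|)`.  (1.128)"
p. 36 [PDF 20]: "cubes □_z of size 2M₀ and with a center at the point z … These cubes cover the lattice T_η".

WHAT THIS MODULE IS.  Kernel GLUE between two certified tree modules, nothing more.  `B5Local114.Realisation`
(PAPER SUB-CELL B05 gen 4; the hypothesis of `B5Local114.local114_of_realisation`, i.e. of the local bound (1.114))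
carries the printed step (1.126) ⇒ (1.128) as the FIELD
`h128 : ∀ δ₀' C, 0 < δ₀' → 0 < C → (∀ x x', |kd.ker x x'| ≤ C e^{−δ₀'·kd.dist x x'}) →
  ∀ z₁ z₂ A, ‖H z₁ (Kop Δa H z₂ A)‖ ≤ κ.thetaBar δ₀' C / M₀ · e^{−2δ₀(δ₀',M₀)·dist(ctr z₁, ctr z₂)} · (‖Dg A‖ + ‖A‖)`.
`B5AveragingTorus.h128_balaban_torus` (gen 6) PROVES (1.128) on the finite-torus model for
`Δ_model = Δ_w + a·Q_k*Q_k + k` with every structural hypothesis discharged and the decay (1.126) of `k` as the only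
analytic input.  THIS FILE states the field as a predicate `H128Shape kd M₀ θ̄ H Δa Dg ctr` (§1), checks BY NAME that
it is literally the field (`h128Shape_of_realisation R : H128Shape … := R.h128`), and proves that the torus model
supplies it for EVERY kernel `k` (§2, `h128Shape_torus`): carrier `V = EuclideanSpace ℝ (UT N × Fin d)` (vector
fields on the fine torus, L² norm), cubes `S = B5TorusCover.Ctr N M₀` with centres `ctr = ctrU N M₀` in `X = UT N`,
partition `H = B5SmoothPartition.HSop`, `Δa = deltaA n a k = kerOp (lapKer axisWC + a·gram120 (n^d) (avgKer n)) +
kerOp k`, kernel data `kernelData N k = (UT N × Fin d, dist of base points, k)` and the constant function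
`θ̄ = thetaBar128 d M₀ n a` (§2; `M₀·(the constant of h128_balaban_torus)`, clipped below at `0` so that it fits the
field `Consts.thetaBar_nonneg` for ALL arguments — `constsWith`).  Hence a successor who instantiates the remaining
fields of `Realisation` on this model (the analytic blocks `G = Δ_a⁻¹`, `h71`, `h89`, `hcert`, `hentry`: cell GAPS
G-B5-27/28, NOT touched here) takes `h128 := h128Shape_torus …` verbatim.

HONEST LABELLING.  Nothing here is a claim of the paper beyond the two displays quoted; every statement is
kernel-proved and elementary; decls marked MODEL are this library's; [folklore] marks elementary facts.  NOT CLAIMED: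
(1.126) itself (hypothesis of the predicate, B4 territory — cell GAPS G-B5-34/34a); any other field of `Realisation`;
any estimate of the paper.  Imports: `B5AveragingTorus` (hence `B5Averaging120`, `B5Local114`, `B5TorusCover`,
`B5SmoothPartition`, `B5Leibniz121`, `B5Walk131`) and Mathlib.
value = kernel glue between located, certified leaves of one paper — NOT summit progress.
-/
import Mathlib
import Literature.MathematicalPhysics.QuantumFieldTheory.Balaban1983to89.B5AveragingTorus

namespace Literature.MathematicalPhysics.QuantumFieldTheory.Balaban1983to89.B5Realisation128

open B5TorusCover (UT Ctr ctrU)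
open B5Commutator128 (kerOp)
open B5SmoothPartition (HSop)
open B5Leibniz121 (lapKer dirichlet axisWC)
open B5Averaging120 (gram120)
open B5AveragingTorus (avgKer h128_balaban_torus)
open B5Local114 (Kop Realisation Consts)
open B5Walk131 (twoDelta0)

noncomputable section

/-! ## §1  The field `Realisation.h128` as a stand-alone predicate -/

section Shape

variable {V : Type} [NormedAddCommGroup V] [InnerProductSpace ℝ V] {X : Type} [PseudoMetricSpace X]
  {S : Type} [Fintype S]

/-- THE SHAPE OF (1.126) ⇒ (1.128) as carried by `B5Local114.Realisation.h128`: for all decay constants `δ₀', C > 0`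
of the kernel `kd.ker` (the (1.126) input), the bound (1.128) p. 38 — "Defining `2δ₀ = min{⅓δ′₀, M₀⁻¹}`, we obtain
`|h_{z₁}K(h_{z₂})A| ≤ O(M₀⁻¹) e^{−2δ₀|z₁−z₂|} (|∇A| + |A|)`.  (1.128)" — in L² form with `O(M₀⁻¹) = θ̄(δ₀',C)/M₀`
and `2δ₀ = B5Walk131.twoDelta0 δ₀' M₀`.  MODEL-level predicate (library's). [cite: Balaban1984PropagatorsI, (1.128) p.38] -/
def H128Shape (kd : B5.KernelData) (M₀ : ℕ) (thetaBar : ℝ → ℝ → ℝ) (H : S → Module.End ℝ V)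
    (Δa Dg : Module.End ℝ V) (ctr : S → X) : Prop :=
  ∀ δ₀' C : ℝ, 0 < δ₀' → 0 < C →
    (∀ x x' : kd.X, |kd.ker x x'| ≤ C * Real.exp (-(δ₀' * kd.dist x x'))) →
    ∀ (z₁ z₂ : S) (A : V), ‖H z₁ (Kop Δa H z₂ A)‖
      ≤ thetaBar δ₀' C / M₀ * Real.exp (-(twoDelta0 δ₀' M₀ * dist (ctr z₁) (ctr z₂))) * (‖Dg A‖ + ‖A‖)

/-- BY NAME: the field `h128` of ANY realisation is literally an `H128Shape` (the proof term is the projection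
itself, so the two types are definitionally the same). [folklore] -/
theorem h128Shape_of_realisation {St : B5.Setting} {kd : B5.KernelData} {M₀ : ℕ} {κ : Consts}
    (R : Realisation St kd M₀ κ V X S) : H128Shape kd M₀ κ.thetaBar R.H R.Δa R.Dg R.ctr :=
  R.h128

omit [Fintype S] in
/-- Monotonicity of the shape in the constant function: a larger `θ̄` is still a valid (1.128) constant. [folklore] -/
theorem H128Shape.mono {kd : B5.KernelData} {M₀ : ℕ} {θ₁ θ₂ : ℝ → ℝ → ℝ} {H : S → Module.End ℝ V}
    {Δa Dg : Module.End ℝ V} {ctr : S → X} (h : H128Shape kd M₀ θ₁ H Δa Dg ctr)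
    (hle : ∀ δ C, 0 < δ → 0 < C → θ₁ δ C ≤ θ₂ δ C) : H128Shape kd M₀ θ₂ H Δa Dg ctr := by
  intro δ₀' C hδ hC hker z₁ z₂ A
  refine (h δ₀' C hδ hC hker z₁ z₂ A).trans ?_
  have hE : 0 ≤ Real.exp (-(twoDelta0 δ₀' M₀ * dist (ctr z₁) (ctr z₂))) * (‖Dg A‖ + ‖A‖) := by positivity
  have hq : θ₁ δ₀' C / M₀ ≤ θ₂ δ₀' C / M₀ :=
    div_le_div_of_nonneg_right (hle δ₀' C hδ hC) (Nat.cast_nonneg M₀)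
  calc θ₁ δ₀' C / M₀ * Real.exp (-(twoDelta0 δ₀' M₀ * dist (ctr z₁) (ctr z₂))) * (‖Dg A‖ + ‖A‖)
      = θ₁ δ₀' C / M₀ * (Real.exp (-(twoDelta0 δ₀' M₀ * dist (ctr z₁) (ctr z₂))) * (‖Dg A‖ + ‖A‖)) := by ring
    _ ≤ θ₂ δ₀' C / M₀ * (Real.exp (-(twoDelta0 δ₀' M₀ * dist (ctr z₁) (ctr z₂))) * (‖Dg A‖ + ‖A‖)) :=
        mul_le_mul_of_nonneg_right hq hE
    _ = θ₂ δ₀' C / M₀ * Real.exp (-(twoDelta0 δ₀' M₀ * dist (ctr z₁) (ctr z₂))) * (‖Dg A‖ + ‖A‖) := by ring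

end Shape

/-! ## §2  The torus model supplies the field -/

section Torus

variable {d : ℕ} {N : Fin d → ℕ} [∀ i, NeZero (N i)]

/-- MODEL: the kernel data of the torus model — indices of vector-field components `UT N × Fin d`, the distance of
the BASE POINTS (the sup circular distance of `B5TorusCover`), and the kernel `k` standing for the `∂P∂*` kernel of
(1.126). [folklore] -/
def kernelData (N : Fin d → ℕ) [∀ i, NeZero (N i)] (k : UT N × Fin d → UT N × Fin d → ℝ) : B5.KernelData where
  X := UT N × Fin d
  dist x x' := dist x.1 x'.1
  ker := k

/-- MODEL: the operator `Δ_model = Δ_w + a·Q_k*Q_k + k` of `B5AveragingTorus.h128_balaban_torus` on vector fields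
(`n` fine steps per block, averaging kernel `avgKer n` of (1.18), weight `n^d = η^{−d}`). [folklore] -/
def deltaA (n : ℕ) (a : ℝ) (k : UT N × Fin d → UT N × Fin d → ℝ) :
    Module.End ℝ (EuclideanSpace ℝ (UT N × Fin d)) :=
  kerOp (fun i j => lapKer axisWC i j + a * gram120 ((n : ℝ) ^ d) (avgKer n) i j) + kerOp k

/-- The constant of `B5AveragingTorus.h128_balaban_torus` as a function of the decay data `(δ, C)` of `k` (cube
size `M₀` in fine steps, `n` fine steps per block, averaging weight `a`). [folklore] -/
def const128 (d M₀ n : ℕ) (a δ C : ℝ) : ℝ :=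
  ((4 * d / M₀ * Real.sqrt (2 * d) + 52 * d / (M₀ : ℝ) ^ 2) + 4 * d / M₀ * (4 * n) * |a|)
      * Real.exp (4 + 4 * n / M₀)
    + 4 * d / M₀ * C * (24 / (Real.exp 1 * δ)) * (d * B4Sect5Proof.latticeConst d (δ / 8)) * Real.exp 7

/-- MODEL: the (1.128) constant function `θ̄(δ₀', C)` of the torus model: `M₀ · const128`, clipped below at `0` (so
that `θ̄ ≥ 0` for ALL arguments, as the field `Consts.thetaBar_nonneg` demands; for the arguments that matter only
`θ̄/M₀ ≥ const128` is used). [folklore] -/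
def thetaBar128 (d M₀ n : ℕ) (a : ℝ) (δ C : ℝ) : ℝ := max ((M₀ : ℝ) * const128 d M₀ n a δ C) 0

/-- `θ̄ ≥ 0` for all arguments. [folklore] -/
theorem thetaBar128_nonneg (d M₀ n : ℕ) (a δ C : ℝ) : 0 ≤ thetaBar128 d M₀ n a δ C := by
  unfold thetaBar128
  exact le_max_right _ _

/-- `θ̄/M₀` dominates the constant of `h128_balaban_torus` (for `M₀ ≥ 1`). [folklore] -/
theorem const128_le_thetaBar128_div {M₀ : ℕ} (hM : 1 ≤ M₀) (d n : ℕ) (a δ C : ℝ) :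
    const128 d M₀ n a δ C ≤ thetaBar128 d M₀ n a δ C / M₀ := by
  have hM0 : (0 : ℝ) < M₀ := by exact_mod_cast hM
  rw [le_div_iff₀ hM0, thetaBar128, mul_comm]
  exact le_max_left _ _

/-- THE TORUS MODEL SUPPLIES `Realisation.h128`: for every kernel `k`, the predicate `H128Shape` holds for the data
(`kernelData N k`, `M₀`, `thetaBar128 d M₀ n a`, `HSop`, `deltaA n a k`, `Dg`, `ctrU`) — i.e. (1.126) for `k` with
ANY constants `δ₀', C > 0` implies (1.128) with `θ̄(δ₀',C)/M₀` and `2δ₀ = twoDelta0 δ₀' M₀`, uniformly in the volume;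
from `B5AveragingTorus.h128_balaban_torus` by name.  Standing structural hypotheses as there: `1 ≤ M₀`, `2M₀ ≤ N_i`,
`1 ≤ n`, `1 ≤ N_i/n`, and a gradient operator `Dg` dominating `√(dirichlet axisWC ·)`.
[cite: Balaban1984PropagatorsI, (1.128) p.38] -/
theorem h128Shape_torus {M₀ n : ℕ} (hM : 1 ≤ M₀) (h2N : ∀ i, 2 * M₀ ≤ N i) (hn : 1 ≤ n)
    (hq : ∀ i, 1 ≤ N i / n) {Dg : Module.End ℝ (EuclideanSpace ℝ (UT N × Fin d))}
    (hDg : ∀ A, Real.sqrt (dirichlet (axisWC (N := N) (κ := Fin d)) A) ≤ ‖Dg A‖) (a : ℝ)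
    (k : UT N × Fin d → UT N × Fin d → ℝ) :
    H128Shape (kernelData N k) M₀ (thetaBar128 d M₀ n a) (HSop N M₀ fun p : UT N × Fin d => p.1)
      (deltaA n a k) Dg (ctrU N M₀) := by
  intro δ₀' C hδ hC hker z₁ z₂ A
  have h := h128_balaban_torus hM h2N hn hq hDg a (k := k) (C := C) (δ := δ₀') hker hC.le hδ z₁ z₂ A
  refine h.trans ?_
  have hE : 0 ≤ Real.exp (-(twoDelta0 δ₀' M₀ * dist (ctrU N M₀ z₁) (ctrU N M₀ z₂))) * (‖Dg A‖ + ‖A‖) := by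
    positivity
  have hle : const128 d M₀ n a δ₀' C ≤ thetaBar128 d M₀ n a δ₀' C / M₀ := const128_le_thetaBar128_div hM d n a δ₀' C
  have key := mul_le_mul_of_nonneg_right hle hE
  simpa only [const128, mul_assoc] using key

/-- MODEL: plugging `θ̄ := thetaBar128 d M₀ n a` into any record of uniform constants `κ₀ : Consts` (all other
constants kept). [folklore] -/
def constsWith (κ₀ : Consts) (d M₀ n : ℕ) (a : ℝ) : Consts :=
  { κ₀ with thetaBar := thetaBar128 d M₀ n a, thetaBar_nonneg := thetaBar128_nonneg d M₀ n a }

/-- The `θ̄` of `constsWith κ₀ …` is `thetaBar128 …`. [folklore] -/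
@[simp] theorem constsWith_thetaBar (κ₀ : Consts) (d M₀ n : ℕ) (a : ℝ) :
    (constsWith κ₀ d M₀ n a).thetaBar = thetaBar128 d M₀ n a := rfl

/-- The same statement with the constant read off a `Consts` record — the literal type of the field `h128` of a
`Realisation St (kernelData N k) M₀ (constsWith κ₀ d M₀ n a) (EuclideanSpace ℝ (UT N × Fin d)) (UT N) (Ctr N M₀)`
whose `H`, `Δa`, `Dg`, `ctr` are the model's. [cite: Balaban1984PropagatorsI, (1.128) p.38] -/
theorem h128_field_torus (κ₀ : Consts) {M₀ n : ℕ} (hM : 1 ≤ M₀) (h2N : ∀ i, 2 * M₀ ≤ N i) (hn : 1 ≤ n)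
    (hq : ∀ i, 1 ≤ N i / n) {Dg : Module.End ℝ (EuclideanSpace ℝ (UT N × Fin d))}
    (hDg : ∀ A, Real.sqrt (dirichlet (axisWC (N := N) (κ := Fin d)) A) ≤ ‖Dg A‖) (a : ℝ)
    (k : UT N × Fin d → UT N × Fin d → ℝ) :
    ∀ δ₀' C : ℝ, 0 < δ₀' → 0 < C →
      (∀ x x' : (kernelData N k).X, |(kernelData N k).ker x x'|
          ≤ C * Real.exp (-(δ₀' * (kernelData N k).dist x x'))) →
      ∀ (z₁ z₂ : Ctr N M₀) (A : EuclideanSpace ℝ (UT N × Fin d)),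
        ‖HSop N M₀ (fun p : UT N × Fin d => p.1) z₁
            (Kop (deltaA n a k) (HSop N M₀ fun p : UT N × Fin d => p.1) z₂ A)‖
          ≤ (constsWith κ₀ d M₀ n a).thetaBar δ₀' C / M₀
              * Real.exp (-(twoDelta0 δ₀' M₀ * dist (ctrU N M₀ z₁) (ctrU N M₀ z₂))) * (‖Dg A‖ + ‖A‖) :=
  h128Shape_torus hM h2N hn hq hDg a k

/-- CONVERSELY (shape check in the other direction): if a realisation of the torus model has the model's `H`, `Δa`,
`Dg`, `ctr`, then its field `h128` is an instance of `H128Shape` with the record's `θ̄` — so `h128Shape_torus` is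
exactly what such a record must contain (up to the choice of `θ̄`, cf. `H128Shape.mono`). [folklore] -/
theorem h128Shape_of_torus_realisation {St : B5.Setting} {M₀ : ℕ} {κ : Consts}
    {k : UT N × Fin d → UT N × Fin d → ℝ}
    (R : Realisation St (kernelData N k) M₀ κ (EuclideanSpace ℝ (UT N × Fin d)) (UT N) (Ctr N M₀)) :
    H128Shape (kernelData N k) M₀ κ.thetaBar R.H R.Δa R.Dg R.ctr :=
  h128Shape_of_realisation R

end Torus

end

end Literature.MathematicalPhysics.QuantumFieldTheory.Balaban1983to89.B5Realisation128
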